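import Literature.Barriers.ValiantsHypothesis.BDGIL24IsotypicNaturalProofs
import Literature.Computability.AlgebraicComplexity.HwvIdealRankBound
import Literature.Computability.AlgebraicComplexity.OrbitClosureWeights
import HarnessLib

/-!
# BDGIL24 ↔ IK20 bridge: isotypic equations of an orbit closure vs. multiplicity drops

Dictionary item (ii) asked for by the val-lit BIP lead (V3 ↔ V4): over `ℂ`, for a form `f` in `k`
variables, degree `m ≠ 0` and a weight `χ`,

  `orbitMultiplicity ℂ f m χ < plethysmCoeff ℂ (Fin k) m χ`
  `↔ ∃ F ≠ 0, F ∈ highestWeightSpace (coordRep (Fin k) ℂ m) χ ∧ F ∈ orbitVanishingIdeal f m`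

(a strict multiplicity drop at `χ` — the "smaller side" of a GCT multiplicity / vanishing-ideal
occurrence obstruction, `IsVanishingIdealOccurrenceObstructionAt` of `ObstructionTypes` — is the
same thing as a nonzero weight-`χ` highest-weight EQUATION of the orbit closure), and such an `F`
is an isotypic metapolynomial vanishing on the orbit in the sense of [BergEtAl2024] §2.5
(`BergEtAl2024.IsIsotypic`). Both directions are the tree's rank–nullity identity
`orbitMultiplicity_add_finrank_inf_eq_plethysmCoeff` (Dörfler–Ikenmeyer–Panova 2020 §5) read off;
nothing new is assumed. Proof-only support file; nothing here bears on the truth of `VP ≠ VNP`.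
-/

noncomputable section

open MvPolynomial

namespace Literature.Barriers.ValiantsHypothesis

namespace BergEtAl2024

open Literature.Computability.AlgebraicComplexity Literature.NumberTheory.DiophantineGeometry

/-- **Multiplicity drop ⟺ a highest-weight equation** (rank–nullity, DIP20 §5 / BI13 (5.1)–(5.2)):
for `m ≠ 0`, `mult_χ ℂ[Δ_m[f]] < a_χ(m)` iff some nonzero weight-`χ` highest-weight vector of
`ℂ[Sym^m]` lies in the vanishing ideal of the orbit of `f`.
[cite: DorflerIkenmeyerPanova2020, §5 (rank–nullity for highest-weight vectors of the ideal)] -/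
theorem orbitMultiplicity_lt_plethysmCoeff_iff_exists_hwv {k m : ℕ} (hm : m ≠ 0)
    (f : MvPolynomial (Fin k) ℂ) (χ : Weight (Fin k)) :
    orbitMultiplicity ℂ f m χ < plethysmCoeff ℂ (Fin k) m χ ↔
      ∃ F : MvPolynomial (DegIdx (Fin k) m) ℂ, F ≠ 0 ∧
        F ∈ highestWeightSpace (coordRep (Fin k) ℂ m) χ ∧ F ∈ orbitVanishingIdeal f m := by
  constructor
  · intro hlt
    have heq := orbitMultiplicity_add_finrank_inf_eq_plethysmCoeff (k := ℂ) f hm χ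
    have hpos : 0 < Module.finrank ℂ ↥(highestWeightSpace (coordRep (Fin k) ℂ m) χ ⊓
        (orbitVanishingIdeal f m).restrictScalars ℂ) := by omega
    haveI := Module.finite_of_finrank_pos hpos
    obtain ⟨⟨F, hF⟩, hF0⟩ := Module.finrank_pos_iff_exists_ne_zero.1 hpos
    refine ⟨F, fun h => hF0 (Subtype.ext h), hF.1, ?_⟩
    exact hF.2
  · rintro ⟨F, hF0, hFχ, hFI⟩
    exact orbitMultiplicity_lt_plethysmCoeff_of_mem_orbitVanishingIdeal hm hFχ hFI hF0

/-- **The V3 ↔ V4 dictionary, proved:** a strict multiplicity drop of `χ` in `ℂ[Δ_m[f]]` yields a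
nonzero ISOTYPIC metapolynomial (in the sense of [BergEtAl2024] §2.5) vanishing at every point of
the orbit `GL_k · f` — an "isotypic equation" for the orbit closure of `f`.
[cite: BergEtAl2024, §2.3, p.8 (highest weight vectors as obstructions)] locator: paper:arxiv-2411.03444 p0009.txt:L1–L7 -/
theorem exists_isIsotypic_vanishing_of_orbitMultiplicity_lt {k m : ℕ} (hm : m ≠ 0)
    (f : MvPolynomial (Fin k) ℂ) (χ : Weight (Fin k))
    (hlt : orbitMultiplicity ℂ f m χ < plethysmCoeff ℂ (Fin k) m χ) :
    ∃ F : MvPolynomial (DegIdx (Fin k) m) ℂ, F ≠ 0 ∧ IsIsotypic F ∧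
      ∀ g : GL (Fin k) ℂ, aeval (formCoeff m (linSubstRep (Fin k) ℂ g f)) F = 0 := by
  obtain ⟨F, hF0, hFχ, hFI⟩ := (orbitMultiplicity_lt_plethysmCoeff_iff_exists_hwv hm f χ).1 hlt
  exact ⟨F, hF0, ⟨χ, highestWeightSpace_le_hwSubrep _ χ hFχ⟩, mem_orbitVanishingIdeal_iff.1 hFI⟩


/-! ### The torus weight decomposition of a metapolynomial (shape of `thm_1_1_weight`) -/

/-- **Weight decomposition by multigrading.** Every metapolynomial `Δ` of format `(·, d, k)` has,
for every torus weight `χ`, a weight-`χ` part `Δ'` (the sum of its metamonomials `s` with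
`monWeight s = χ`, tree `OrbitClosureWeights.monWeight`) with `Δ - Δ'` in the span of the other
weight spaces — the decomposition presupposed by Thm. 1.1 (1) ("the projection of `Δ` onto the
weight space of weight `μ`"), here PROVED for the tree's `coordRep` (the complexity bound of
`thm_1_1_weight` is the content of the named fact). [cite: BergEtAl2024, Thm. 1.1 (1), p.4 (PDF p.5)] locator: paper:arxiv-2411.03444 p0005.txt:L70–L76 -/
theorem exists_weight_decomposition {d k : ℕ} (Δ : MvPolynomial (DegIdx (Fin k) d) ℂ)
    (χ : Weight (Fin k)) :
    ∃ Δ' : MvPolynomial (DegIdx (Fin k) d) ℂ,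
      Δ' ∈ weightSpace (coordRep (Fin k) ℂ d) χ ∧
      Δ - Δ' ∈ ⨆ χ' ∈ {χ' : Weight (Fin k) | χ' ≠ χ}, weightSpace (coordRep (Fin k) ℂ d) χ' := by
  classical
  -- metamonomials are torus weight vectors
  have hmon : ∀ (s : DegIdx (Fin k) d →₀ ℕ) (c : ℂ),
      (monomial s c : MvPolynomial (DegIdx (Fin k) d) ℂ) ∈
        weightSpace (coordRep (Fin k) ℂ d) (monWeight s) := by
    intro s c t ht
    rw [coordRep_apply, coordSubst_monomial_of_isDiagonalGL ht]
  refine ⟨∑ s ∈ Δ.support with monWeight s = χ, monomial s (coeff s Δ), ?_, ?_⟩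
  · refine Submodule.sum_mem _ fun s hs => ?_
    rw [(Finset.mem_filter.1 hs).2.symm]
    exact hmon s _
  · have hsplit : Δ - ∑ s ∈ Δ.support with monWeight s = χ, monomial s (coeff s Δ) =
        ∑ s ∈ Δ.support with monWeight s ≠ χ, monomial s (coeff s Δ) := by
      rw [sub_eq_iff_eq_add]
      conv_lhs => rw [Δ.as_sum]
      rw [← Finset.sum_filter_add_sum_filter_not Δ.support (fun s => monWeight s = χ), add_comm]
    rw [hsplit]
    refine Submodule.sum_mem _ fun s hs => ?_
    have hne : monWeight s ≠ χ := (Finset.mem_filter.1 hs).2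
    exact Submodule.mem_iSup_of_mem (monWeight s)
      (Submodule.mem_iSup_of_mem (show monWeight s ∈ {χ' : Weight (Fin k) | χ' ≠ χ} from hne)
        (hmon s _))

end BergEtAl2024

end Literature.Barriers.ValiantsHypothesis
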